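import Literature.Analysis.FluidPDE.JiaSverak2015.Divergence
import HarnessLib

/-!
# Ionescu–Jia–Palasek 2026 (arXiv:2606.07501, part I): the fixed-profile conditional theorem, typed

Statement-level reading of A. D. Ionescu, H. Jia, S. Palasek, *On the non-uniqueness of solutions of the
axi-symmetric swirl-free Navier–Stokes equations, I*, arXiv:2606.07501 (June 2026; page numbers = arXiv-PDF
pages) [IonescuJiaPalasek2026] — a PREPRINT (unrefereed), recorded by cell pub-nsjs
(papers/NavierStokesRegularity/ns-jia-sverak) as the first written proof of the FIXED-PROFILE conditional
theorem of the Jia–Šverák programme: one steady self-similar profile `U` and ONE eigenvalue `λ` of the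
linearised operator with `Re λ > 0` (no `σ`-curve, no `1/8` window, no spectral gap, no simplicity) ⇒
non-uniqueness for the unforced equations. Its Theorem 1.2 (p.4) is therefore exactly the shape of the
hypothesis node `JiaSverak2015.UMSetting.NUMHWY` typed in `Divergence.lean` (the package consumed by
Hou–Wang–Yang 2025 §2.3), on the profile / eigenfunction class IJP26 prescribe; `NUMHWY_of_thm12` makes
that identification a theorem. Under the house rule an unrefereed preprint enters as a CLAIM: `Thm12` is a
claim-tagged hypothesis structure, never an instance or an axiom, and its proof (IJP26 §3, pp.10–13) is the
object the cell audits.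

## Theorem 1.2 (p.4), verbatim
"Assume that there are `C²` divergence-free vector fields `(U, Ũ)` and a number `λ` with `Re λ > 0`
satisfying the identities
  `ΔU + ½ x·∇U + ½ U − Π(U·∇U) = 0`,
  `ΔŨ + ½ x·∇Ũ + ½ Ũ − Π(U·∇Ũ + Ũ·∇U) = λ Ũ`,
where `Π` denotes the Leray projection. Assume also that the vector fields `U, Ũ` satisfy the bounds
  `|U(x) − U₀(x)| ≲ ⟨x⟩⁻²`, `|Ũ(x)| ≲ ⟨x⟩⁻²`,
for a divergence-free `−1`-homogeneous vector field `U₀ ∈ C^∞(ℝ³∖{0})`. Then Conjecture 1.1 (i) holds. In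
addition, if the vector fields `U` and `Ũ` are axially symmetric and swirl-free then Conjecture 1.1 (ii)
holds."

## Conjecture 1.1 (p.3), verbatim
"(i) There are two different solutions `u₁, u₂ ∈ C([0,1] : H^α_x) ∩ L²_t H^{α+1}_x ∩ L^∞_t L^{3,∞}_x`, for
any `α ∈ [0, 1/2)`, of the incompressible Navier–Stokes equations (1.1) in `ℝ³`, with the same initial data
`u₁(0) = u₂(0) = u₀ ∈ H^α ∩ L^{3,∞}`, `α ∈ [0, 1/2)`. These solutions are smooth in `(0,1] × ℝ³`, satisfy
`t^{1/2} ‖u_j(t)‖_{L^∞} ≲ 1`, `j ∈ {1,2}`, and satisfy the energy identity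
`½‖u_j(t₀)‖²_{L²} = ½‖u_j(t₁)‖²_{L²} + ∫_{t₀}^{t₁} ‖∇u_j(s)‖²_{L²} ds` for any `t₀ ≤ t₁ ∈ [0,1]` and
`j ∈ {1,2}`. (ii) (Strong form) The solutions `u₁, u₂` are axially symmetric and swirl-free."

## What the typing keeps and drops
* Hypotheses are Props of an abstract `Setting` (no unbounded-operator spectral theory in Mathlib): the
  profile clause `profileOK` and the set `eigPair` of eigenvalues admitting a `C²`, divergence-free,
  `⟨x⟩⁻²`-decaying eigenfunction. The `∃ λ, Re λ > 0` clause is typed literally.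
* The CONCLUSION is bound to the tree's `∃ T v₀ u v, 0 < T ∧ JiaSverak2015.JS15Datum v₀ ∧ JiaSverak2015.IsNonUniqLHPair T v₀ u v` (two strict-sense
  Leray–Hopf solutions on `[0, T)` with a common compactly supported `O(1/|x|)` datum): the printed datum is
  `U_{0l} = ∇×(χ U₀×x)`, "compactly supported and has a singularity of the order `O(1/|x|)` as `x → 0`"
  (Step 3, p.12), the solutions are in `C([0,1] : L²) ∩ L²_t H¹_x` with the energy identity (1.3) from `t = 0`
  (Step 3, p.12–13), hence Leray–Hopf on `[0, 1)`. DROPPED from the printed conclusion: the `H^α` /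
  `L^{3,∞}` / `t^{1/2}L^∞` regularity, smoothness on `(0,1]`, the energy IDENTITY (only the inequality
  survives in `IsLerayHopfOn`), the "infinitely many" (Step 3: every `φ_{u0} ∈ Ran P_u` gives a solution),
  and part (ii) (the axisymmetric swirl-free property of the solutions), which is recorded separately as
  the setting datum `Setting.assfConclusion` and the claim field `Thm12.implies_assf`. The `JS15Datum.memLp` conjunct is the printed `u₀ ∈ H^α`, `α ≥ 0`.
* Sign: IJP26 and JS15 agree — unstable ⇔ `Re λ > 0`.

## What is deliberately NOT here
* No proof of Thm. 1.2: its proof (§3: Prop. 3.1 spectral structure of `𝓛_U` on `X = L² ∩ L⁴` incl. the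
  a-priori bound `‖(λ − 𝓛₀)⁻¹ K_U‖ ≲ (1 + |α| + |β|)^{−1/2} ‖U‖_Y`, p.10–11; Steps 1–4: elliptic bootstrap
  `⟨x⟩⁻² → ⟨x⟩⁻³` asserted "similar to the arguments in [JiSv1]", localisation `U₀ = U_{0l} + U_{0f}`,
  backward Lyapunov–Perron fixed point in `E_η`, `η = min{1/100, γ_u/4}`, symmetry preservation) is
  PDE analysis far from Mathlib and is under audit by the cell (GAPS.md G8–G9).
* No instantiation of `Setting` by the actual operator.

## References
* A. D. Ionescu, H. Jia, S. Palasek, arXiv:2606.07501 (2026): Conj. 1.1 p.3, Thm. 1.2 p.4, Main Numerical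
  Result 1.3 p.5 (σ = 130, λ* = 0.235059597921, residuals ≤ 3·10⁻¹⁰ — numerics, not cited as a fact),
  §3 pp.10–13. [IonescuJiaPalasek2026]
* H. Jia, V. Šverák, J. Funct. Anal. 268 (2015) (the `σ`-curve theorems; `Statements.lean`). [JiaSverak2015]
* T. Y. Hou, Y. Wang, C. Yang, arXiv:2509.25116 (2025) (the same fixed-profile shape, §2.3; unrefereed
  claim). [HouWangYang2025]
-/

open MeasureTheory Set

namespace Literature.Analysis.FluidPDE.IonescuJiaPalasek2026

open JiaSverak2015

/-- File-local notation, identical to `JiaSverak2015/Statements.lean`. -/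
local notation "ℝ³" => EuclideanSpace ℝ (Fin 3)

/-- The objects IJP26 Thm. 1.2 (p.4) quantifies over, as bare Props / sets (no analysis encoded).
[cite: IonescuJiaPalasek2026, Thm. 1.2 p.4] -/
structure Setting where
  /-- H-IJP1 (Thm. 1.2, first hypothesis block): "`C²` divergence-free vector field `U`" with
  `ΔU + ½ x·∇U + ½ U − Π(U·∇U) = 0` and `|U(x) − U₀(x)| ≲ ⟨x⟩⁻²` "for a divergence-free `−1`-homogeneous
  vector field `U₀ ∈ C^∞(ℝ³∖{0})`". NOTE (cell pub-nsjs, DIVERGENCE D13): the printed bound carries no range in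
  `x`; read literally it forces `U₀ ≡ 0` off the origin (a `C²` `U` is bounded near `0`, a non-zero
  `−1`-homogeneous `U₀` is not — kernel-checked `JiaSverak2014.ProfileHypLiteral.datum_eq_zero_of_ne`), so the
  reading this Prop is meant to carry, and the one typed in `JiaSverak2014.ProfileHyp.close`, is `|x| ≥ 1`. -/
  profileOK : Prop
  /-- `eigPair`: the set of `λ ∈ ℂ` for which some `C²` divergence-free `Ũ` with `|Ũ(x)| ≲ ⟨x⟩⁻²` satisfies
  `ΔŨ + ½ x·∇Ũ + ½ Ũ − Π(U·∇Ũ + Ũ·∇U) = λ Ũ` (Thm. 1.2, second identity and second bound). NOTE (cell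
  pub-nsjs, DIVERGENCE D12): the printed Thm. 1.2 (p.4) does not require `Ũ ≢ 0`; as printed the hypothesis is
  met by `Ũ = 0` for every `λ`, so the intended reading — and the one this set carries — is `Ũ ≠ 0` (an
  eigenvalue, not merely a solution of the eigen-equation); any certificate instantiating `eigPair` must
  therefore bound `‖Ũ‖` BELOW as well as bound the residual. The concrete eigenpair class (componentwise
  eigen-equation over `ℂ`) is typed in the cell's `JiaSverak2014/Statements.lean`, likewise without the
  non-triviality clause. -/
  eigPair : Set ℂ
  /-- H-IJP-ASSF (Thm. 1.2, last sentence): "the vector fields `U` and `Ũ` are axially symmetric and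
  swirl-free" (for the witnessing `Ũ`). -/
  assf : Prop
  /-- Conj. 1.1 (ii): the two solutions are axially symmetric and swirl-free. Data of the setting (an opaque
  Prop naming the printed clause — the tree has no axisymmetry predicate on time-dependent fields), NOT a field
  of the claim, so that a claim cannot choose its own (ii)-conclusion. -/
  assfConclusion : Prop

namespace Setting

variable (S : Setting)

/-- The hypothesis of IJP26 Thm. 1.2: the profile clause and "a number `λ` with `Re λ > 0`" admitting an
eigenfunction of the prescribed class. [cite: IonescuJiaPalasek2026, Thm. 1.2 p.4] -/
def Hyp : Prop := S.profileOK ∧ ∃ z ∈ S.eigPair, 0 < z.re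

/-- The fixed-profile setting of `Divergence.lean` induced by an IJP26 setting: same profile clause, the
eigenvalue set `eigPair`, and no simplicity information (IJP26 never uses simplicity). [folklore] -/
def toUM : UMSetting := ⟨S.profileOK, S.eigPair, fun _ => True⟩

/-- IJP26's hypothesis IS the HWY-shaped package of `Divergence.lean` (definitional). [folklore] -/
theorem hyp_iff_umHypothesesHWY : S.Hyp ↔ S.toUM.UMHypothesesHWY := Iff.rfl

/-- **IJP26 Theorem 1.2 as a CLAIM** (preprint, unrefereed; proof in §3 pp.10–13, under audit): the
hypothesis `Hyp` yields the tree's local Leray–Hopf non-uniqueness conclusion, and under H-IJP-ASSF the two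
solutions are axially symmetric and swirl-free (Conj. 1.1 (ii); recorded as a bare Prop since the tree has no
axisymmetry predicate on time-dependent fields). A hypothesis STRUCTURE — never an instance, never an
axiom; consumers take a `C : S.Thm12` explicitly. Source: Thm. 1.2 p.4; the datum class `JS15Datum v₀` of
`implies` (compact support, `O(1/|x|)` at `0`) is read from the PROOF, §3 Step 3 p.12, not from the printed
statement (Conj. 1.1 (i) says only `u₀ ∈ H^α ∩ L^{3,∞}`). [claim: IonescuJiaPalasek2026, status: under-review] -/
structure Thm12 where
  /-- Conjecture 1.1 (i), read down to the tree's conclusion (see the module docstring for the dropped clauses). -/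
  implies : S.Hyp → (∃ (T : ℝ) (v₀ : ℝ³ → ℝ³) (u v : ℝ → ℝ³ → ℝ³), 0 < T ∧ JS15Datum v₀ ∧ IsNonUniqLHPair T v₀ u v)
  /-- the (ii)-implication: `Hyp ∧ assf → S.assfConclusion` (Conj. 1.1 (ii) as printed: the solutions of part
  (i) "are axially symmetric and swirl-free" when `U, Ũ` are; the conclusion is the SETTING's datum). -/
  implies_assf : S.Hyp → S.assf → S.assfConclusion

/-- **The identification.** A (claimed) IJP26 Thm. 1.2 is precisely an assembly `NUMHWY` for the induced
fixed-profile setting: the node typed in `Divergence.lean` as "not in print" is, since June 2026, a preprint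
theorem on IJP26's profile / eigenfunction class. Its AUDIT (GAPS.md G8–G9) — not this modus ponens — is
what would discharge `NUMHWY`. [folklore] -/
theorem NUMHWY_of_thm12 (C : S.Thm12) : S.toUM.NUMHWY := ⟨fun h => C.implies h⟩

/-- Hence also the JS-shaped assembly `NUM` (through `NUM.ofHWY`). [folklore] -/
theorem NUM_of_thm12 (C : S.Thm12) : S.toUM.NUM := UMSetting.NUM.ofHWY _ (S.NUMHWY_of_thm12 C)

/-- Assembly: the claimed theorem plus a certified hypothesis package gives the conclusion — modus ponens,
making explicit that exactly `Thm12` (a claim) and `Hyp` are consumed. [folklore] -/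
theorem assembly_IJP (C : S.Thm12) (h : S.Hyp) :
    (∃ (T : ℝ) (v₀ : ℝ³ → ℝ³) (u v : ℝ → ℝ³ → ℝ³), 0 < T ∧ JS15Datum v₀ ∧ IsNonUniqLHPair T v₀ u v) :=
  C.implies h

end Setting

end Literature.Analysis.FluidPDE.IonescuJiaPalasek2026
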